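import Mathlib
import HarnessLib
import Summits.Ventures.LatticeQCDFlow.Exactness.SphereGeodesicKick
import Summits.Ventures.LatticeQCDFlow.Exactness.SphereTangentialLaplacian
import Summits.Ventures.LatticeQCDFlow.Exactness.SphereLOFlowAction
import Summits.Ventures.LatticeQCDFlow.Exactness.SphereNLOFlowTerms

/-!
# The site gradients `∂̃_k` of the staple, cross and square terms: the building blocks of the next-to-leading-order generator `T⁽¹⁾ = −∂̃ S̃⁽¹⁾`

HONEST FRAMING: exact (Metropolis-corrected) sampling algorithms for lattice gauge theory;
figures of merit are autocorrelation/cost numbers at stated couplings and volumes; no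
continuum-physics claim.

Venture `LatticeQCDFlow` (cell pub-lqcd), topic `Exactness`; FANOUT row 7 (`s0-cpn-null`: the
S0-D1 rung — 2D CP⁹, Lüscher's LO trivializing map inside HMC, Engel–Schaefer 2011).  NEW WORK of
the cell (beyond Engel–Schaefer, who implement the leading order) over the tree's
`SphereLOFlowAction.lean` (`siteGrad`, couplings with no self-coupling and adjoint pairs,
`hasGradientAt_inner_comp_normalize`), `SphereTangentialLaplacian.lean` (`fderiv_comp_normalize`),
`SphereGeodesicKick.lean` (`tangentKick`) and `SphereNLOFlowTerms.lean` (`stapleTerm`, `crossTerm`,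
`squareTerm` and their sections in one site variable); nothing is cited as a fact.  Printed
counterparts, NAMED ONLY: M. Lüscher, Commun. Math. Phys. 293 (2010) 899, §4.2 eq. (4.4) (the
generator `Z_t = −∂S̃_t`, so `Z⁽¹⁾ = −∂S̃⁽¹⁾`); Engel–Schaefer, Comput. Phys. Commun. 182 (2011)
2107, §2.2 eq. (12), §3 eqs. (14), (16).

## Content (`E` finite-dimensional; `‖x k‖ = 1`; `P_u v = tangentKick v u = v − ⟪v, u⟫ u` the
tangential projection at the unit vector `u`)

* §1 SITE-GRADIENT CALCULUS (the `∂̃` analogue of `SphereSiteLaplacianCalculus.lean`):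
  `siteGrad_eq_of_forall`, **`siteGrad_of_const`** (`0`), **`siteGrad_of_affine`**
  (`∂̃_n G = P_{x_n} w` for `G(x_n ← y) = ⟪w, y⟫ + c`), `hasGradientAt_inner_mul_inner_comp_normalize`,
  **`siteGrad_of_quadratic`** (`∂̃_n G = P_{x_n}(⟪b, x_n⟫ a + ⟪a, x_n⟫ b)` for
  `G(x_n ← y) = ⟪a, y⟫⟪b, y⟫`), `tangentKick_add`, linearity `siteGrad_add/_const_mul/_finset_sum`
  (for `C¹` summands).
* §2 THE SITE GRADIENTS OF THE THREE TERMS (`n, m, m'` the term's indices, `k` the site):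
  **`siteGrad_stapleTerm_left/_right/_other`** — `∂̃_m a = P_{x_m}(U_{mn} U_{nm'} x_{m'})`,
  `∂̃_{m'} a = P_{x_{m'}}(U_{m'n} U_{nm} x_m)`, else `0`;
  **`siteGrad_crossTerm_self/_left/_right/_other`** — `∂̃_n b = P_{x_n}(⟪a₂, x_n⟫ a₁ + ⟪a₁, x_n⟫ a₂)`
  (`a₁ = U_{nm} x_m`, `a₂ = U_{nm'} x_{m'}`), `∂̃_m b = P_{x_m}(⟪a₂, x_n⟫ U_{mn} x_n)`,
  `∂̃_{m'} b = P_{x_{m'}}(⟪a₁, x_n⟫ U_{m'n} x_n)`, else `0`;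
  **`siteGrad_squareTerm_self/_other_site/_other`** — `∂̃_n c = P_{x_n}(2⟪a, x_n⟫ a)`,
  `∂̃_m c = P_{x_m}(2⟪w, x_m⟫ w)` (`w = U_{mn} x_n`), else `0`.
  With `S̃⁽¹⁾ = −(2κ²/(d−1)) [A/(2d−1) − B/(4d−2) − C/(4d)]` (`SphereNLOFlowAction.lean`) and the
  linearity of §1 these assemble the NLO generator `T⁽¹⁾_k = −∂̃_k S̃⁽¹⁾` site by site as a finite
  sum of tangential projections of transported neighbour data (staples `U_{kn}U_{nm}x_m`,
  `⟪J_n, x_n⟫ U_{kn} x_n`, `⟪U_{km}x_m, x_k⟫ U_{km}x_m`).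

NOT CLAIMED: the collected closed form of `T⁽¹⁾` as a single local field, the flow it generates, its
Jacobian or any exactness statement for a map built from it (the tree's THMC theorems apply to any
bijective `C¹` map with its exact Jacobian, which is not constructed here); anything quantitative.
-/

noncomputable section

namespace Summit.Ventures.LatticeQCDFlow.Exactness

open NormedSpace Filter InnerProductSpace
open scoped RealInnerProductSpace Topology Gradient

variable {E : Type*} [NormedAddCommGroup E] [InnerProductSpace ℝ E]

/-! ## §1 Site-gradient calculus -/

section Calculus

/-- The tangential projection is additive in the field. -/
theorem tangentKick_add (v w u : E) : tangentKick (v + w) u = tangentKick v u + tangentKick w u := by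
  simp only [tangentKick, inner_add_left, add_smul]
  abel

/-- The tangential projection of `0` is `0`. -/
theorem tangentKick_zero_left (u : E) : tangentKick 0 u = 0 := by
  simp [tangentKick]

variable [FiniteDimensional ℝ E]

/-- **The natural gradient of a product of two linear functions** at a unit vector `u`:
`∇((⟪a,·⟫⟪b,·⟫) ∘ ν)(u) = P_u(⟪b, u⟫ a + ⟪a, u⟫ b)`. -/
theorem hasGradientAt_inner_mul_inner_comp_normalize {u : E} (hu : ‖u‖ = 1) (a b : E) :
    HasGradientAt (fun y : E => ⟪a, normalize y⟫ * ⟪b, normalize y⟫)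
      (tangentKick (⟪b, u⟫ • a + ⟪a, u⟫ • b) u) u := by
  have hu0 : u ≠ 0 := by rintro rfl; simp at hu
  have hνu : normalize u = u := normalize_eq_self_of_norm_eq_one hu
  have hf : DifferentiableAt ℝ (fun z : E => ⟪a, z⟫ * ⟪b, z⟫) u :=
    (hasFDerivAt_inner_mul_inner a b u).differentiableAt
  have hg : DifferentiableAt ℝ (fun y : E => ⟪a, normalize y⟫ * ⟪b, normalize y⟫) u := by
    have hf' : DifferentiableAt ℝ (fun z : E => ⟪a, z⟫ * ⟪b, z⟫) (normalize u) := by rwa [hνu]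
    exact hf'.comp u (differentiableAt_normalize hu0)
  have hD : fderiv ℝ (fun y : E => ⟪a, normalize y⟫ * ⟪b, normalize y⟫) u =
      InnerProductSpace.toDual ℝ E (tangentKick (⟪b, u⟫ • a + ⟪a, u⟫ • b) u) := by
    ext h
    have hcn := fderiv_comp_normalize (f := fun z : E => ⟪a, z⟫ * ⟪b, z⟫) hu hf h
    rw [InnerProductSpace.toDual_apply_apply, hcn, (hasFDerivAt_inner_mul_inner a b u).fderiv]
    simp only [add_apply, smul_apply, innerSL_apply_apply, smul_eq_mul, tangentKick,
      inner_sub_left, inner_add_left, inner_smul_left, inner_sub_right, inner_add_right,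
      inner_smul_right, real_inner_comm u, RCLike.conj_to_real]
    ring
  rw [hasGradientAt_iff_hasFDerivAt, ← hD]
  exact hg.hasFDerivAt

variable {Λ : Type*} [DecidableEq Λ]

/-- **Only the section matters**: if `G(x_n ← y) = φ(y)` for all `y`, then
`∂̃_n G (x) = ∇(φ ∘ ν)(x_n)`. -/
theorem siteGrad_eq_of_forall {G : (Λ → E) → ℝ} {x : Λ → E} {n : Λ} {φ : E → ℝ}
    (h : ∀ y, G (Function.update x n y) = φ y) :
    siteGrad n G x = ∇ (fun z : E => φ (normalize z)) (x n) := by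
  unfold siteGrad
  have hfun : (fun y : E => G (Function.update x n (normalize y))) = fun z => φ (normalize z) :=
    funext fun y => h _
  rw [hfun]

/-- **Constant in the site variable ⇒ `∂̃_n G = 0`.** -/
theorem siteGrad_of_const {G : (Λ → E) → ℝ} {x : Λ → E} {n : Λ} {c : ℝ}
    (h : ∀ y, G (Function.update x n y) = c) : siteGrad n G x = 0 := by
  rw [siteGrad_eq_of_forall h]
  exact gradient_fun_const (x n) c

/-- **Affine in the site variable ⇒ `∂̃_n G = P_{x_n} w`.** -/
theorem siteGrad_of_affine {G : (Λ → E) → ℝ} {x : Λ → E} {n : Λ} (hx : ‖x n‖ = 1) {w : E} {c : ℝ}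
    (h : ∀ y, G (Function.update x n y) = ⟪w, y⟫ + c) : siteGrad n G x = tangentKick w (x n) := by
  rw [siteGrad_eq_of_forall h]
  exact (hasGradientAt_inner_comp_normalize hx w c).gradient

/-- **Product of two affine functions in the site variable ⇒ `∂̃_n G = P_{x_n}(⟪b,x_n⟫ a + ⟪a,x_n⟫ b)`.** -/
theorem siteGrad_of_quadratic {G : (Λ → E) → ℝ} {x : Λ → E} {n : Λ} (hx : ‖x n‖ = 1) {a b : E}
    (h : ∀ y, G (Function.update x n y) = ⟪a, y⟫ * ⟪b, y⟫) :
    siteGrad n G x = tangentKick (⟪b, x n⟫ • a + ⟪a, x n⟫ • b) (x n) := by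
  rw [siteGrad_eq_of_forall h]
  exact (hasGradientAt_inner_mul_inner_comp_normalize hx a b).gradient

omit [FiniteDimensional ℝ E] in
/-- Differentiability of a `C¹` section along `ν` at `x_n ≠ 0`. -/
theorem differentiableAt_section_comp_normalize {G : (Λ → E) → ℝ} {x : Λ → E} {n : Λ}
    (hx : x n ≠ 0) (hG : ContDiff ℝ 1 (fun y => G (Function.update x n y))) :
    DifferentiableAt ℝ (fun y : E => G (Function.update x n (normalize y))) (x n) :=
  ((hG.contDiffAt (x := normalize (x n))).comp (x n) (contDiffAt_normalize hx)).differentiableAt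
    (by norm_num)

/-- **Additivity of `∂̃_n`** (summands `C¹` in the site variable, `x_n ≠ 0`). -/
theorem siteGrad_add {G H : (Λ → E) → ℝ} {x : Λ → E} {n : Λ} (hx : x n ≠ 0)
    (hG : ContDiff ℝ 1 (fun y => G (Function.update x n y)))
    (hH : ContDiff ℝ 1 (fun y => H (Function.update x n y))) :
    siteGrad n (fun x' => G x' + H x') x = siteGrad n G x + siteGrad n H x := by
  unfold siteGrad gradient
  rw [← map_add]
  congr 1
  exact fderiv_add (differentiableAt_section_comp_normalize hx hG)
    (differentiableAt_section_comp_normalize hx hH)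

/-- **Scalars**: `∂̃_n (c G) = c ∂̃_n G`. -/
theorem siteGrad_const_mul {G : (Λ → E) → ℝ} {x : Λ → E} {n : Λ} (hx : x n ≠ 0)
    (hG : ContDiff ℝ 1 (fun y => G (Function.update x n y))) (c : ℝ) :
    siteGrad n (fun x' => c * G x') x = c • siteGrad n G x := by
  unfold siteGrad gradient
  rw [← map_smul]
  congr 1
  have h := fderiv_const_mul (differentiableAt_section_comp_normalize hx hG) c
  simpa only [smul_eq_mul] using h

/-- **Finite sums**: `∂̃_n (Σ_i G_i) = Σ_i ∂̃_n G_i`. -/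
theorem siteGrad_finset_sum {ι : Type*} (s : Finset ι) {G : ι → (Λ → E) → ℝ} {x : Λ → E}
    {n : Λ} (hx : x n ≠ 0) (hG : ∀ i ∈ s, ContDiff ℝ 1 (fun y => G i (Function.update x n y))) :
    siteGrad n (fun x' => ∑ i ∈ s, G i x') x = ∑ i ∈ s, siteGrad n (G i) x := by
  classical
  induction s using Finset.induction_on with
  | empty =>
    simp only [Finset.sum_empty]
    exact siteGrad_of_const (c := 0) fun _ => rfl
  | @insert i s hi ih =>
    rw [Finset.sum_insert hi]
    have hG' : ∀ j ∈ s, ContDiff ℝ 1 (fun y => G j (Function.update x n y)) :=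
      fun j hj => hG j (Finset.mem_insert_of_mem hj)
    have hsum : ContDiff ℝ 1 (fun y => ∑ j ∈ s, G j (Function.update x n y)) :=
      ContDiff.sum fun j hj => hG' j hj
    have hfun : (fun x' => ∑ j ∈ insert i s, G j x') = fun x' => G i x' + ∑ j ∈ s, G j x' := by
      funext x'; rw [Finset.sum_insert hi]
    rw [hfun, siteGrad_add (G := G i) (H := fun x' => ∑ j ∈ s, G j x') hx
      (hG i (Finset.mem_insert_self i s)) hsum, ih hG']

end Calculus

/-! ## §2 The site gradients of the staple, cross and square terms -/

section Terms

variable [FiniteDimensional ℝ E] {Λ : Type*} [DecidableEq Λ] {U : Λ → Λ → (E →L[ℝ] E)}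

/-- **Staple term, gradient at site `m`**: `∂̃_m a = P_{x_m}(U_{mn} U_{nm'} x_{m'})` (`m ≠ m'`). -/
theorem siteGrad_stapleTerm_left (hUadj : ∀ m n (v w : E), ⟪U m n v, w⟫ = ⟪v, U n m w⟫)
    {n m m' : Λ} (hmm' : m ≠ m') {x : Λ → E} (hx : ‖x m‖ = 1) :
    siteGrad m (stapleTerm U n m m') x = tangentKick (U m n (U n m' (x m'))) (x m) :=
  siteGrad_of_affine hx (stapleTerm_update_left (n := n) hUadj hmm' x)

/-- **Staple term, gradient at site `m'`**: `∂̃_{m'} a = P_{x_{m'}}(U_{m'n} U_{nm} x_m)` (`m ≠ m'`). -/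
theorem siteGrad_stapleTerm_right (hUadj : ∀ m n (v w : E), ⟪U m n v, w⟫ = ⟪v, U n m w⟫)
    {n m m' : Λ} (hmm' : m ≠ m') {x : Λ → E} (hx : ‖x m'‖ = 1) :
    siteGrad m' (stapleTerm U n m m') x = tangentKick (U m' n (U n m (x m))) (x m') :=
  siteGrad_of_affine hx (stapleTerm_update_right (n := n) hUadj hmm' x)

/-- **Staple term, gradient at any other site**: `0`. -/
theorem siteGrad_stapleTerm_other {n m m' k : Λ} (hkm : k ≠ m) (hkm' : k ≠ m') (x : Λ → E) :
    siteGrad k (stapleTerm U n m m') x = 0 :=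
  siteGrad_of_const (c := stapleTerm U n m m' x) fun y => stapleTerm_update_other hkm hkm' x y

/-- **Cross term, gradient at site `n`** (`m, m' ≠ n` automatic in the value; `m ≠ m'`):
`∂̃_n b = P_{x_n}(⟪a₂, x_n⟫ a₁ + ⟪a₁, x_n⟫ a₂)`, `a₁ = U_{nm} x_m`, `a₂ = U_{nm'} x_{m'}`. -/
theorem siteGrad_crossTerm_self (hU0 : ∀ n, U n n = 0) {n m m' : Λ} (hmm' : m ≠ m') {x : Λ → E}
    (hx : ‖x n‖ = 1) :
    siteGrad n (crossTerm U n m m') x =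
      tangentKick (⟪U n m' (x m'), x n⟫ • U n m (x m) + ⟪U n m (x m), x n⟫ • U n m' (x m')) (x n) :=
  siteGrad_of_quadratic hx (crossTerm_update_self hU0 hmm' x)

/-- **Cross term, gradient at site `m`** (`m ≠ n`, `m ≠ m'`): `∂̃_m b = P_{x_m}(⟪a₂, x_n⟫ U_{mn} x_n)`. -/
theorem siteGrad_crossTerm_left (hUadj : ∀ m n (v w : E), ⟪U m n v, w⟫ = ⟪v, U n m w⟫)
    {n m m' : Λ} (hmm' : m ≠ m') (hmn : m ≠ n) {x : Λ → E} (hx : ‖x m‖ = 1) :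
    siteGrad m (crossTerm U n m m') x = tangentKick (⟪U n m' (x m'), x n⟫ • U m n (x n)) (x m) :=
  siteGrad_of_affine hx (crossTerm_update_left hUadj hmm' hmn x)

/-- **Cross term, gradient at site `m'`** (`m' ≠ n`, `m ≠ m'`): `∂̃_{m'} b = P_{x_{m'}}(⟪a₁, x_n⟫ U_{m'n} x_n)`. -/
theorem siteGrad_crossTerm_right (hUadj : ∀ m n (v w : E), ⟪U m n v, w⟫ = ⟪v, U n m w⟫)
    {n m m' : Λ} (hmm' : m ≠ m') (hm'n : m' ≠ n) {x : Λ → E} (hx : ‖x m'‖ = 1) :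
    siteGrad m' (crossTerm U n m m') x = tangentKick (⟪U n m (x m), x n⟫ • U m' n (x n)) (x m') :=
  siteGrad_of_affine hx (crossTerm_update_right hUadj hmm' hm'n x)

/-- **Cross term, gradient at any other site**: `0`. -/
theorem siteGrad_crossTerm_other {n m m' k : Λ} (hkn : k ≠ n) (hkm : k ≠ m) (hkm' : k ≠ m')
    (x : Λ → E) : siteGrad k (crossTerm U n m m') x = 0 :=
  siteGrad_of_const (c := crossTerm U n m m' x) fun y => crossTerm_update_other hkn hkm hkm' x y

/-- **Square term, gradient at site `n`**: `∂̃_n c = P_{x_n}(2⟪a, x_n⟫ a)`, `a = U_{nm} x_m`. -/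
theorem siteGrad_squareTerm_self (hU0 : ∀ n, U n n = 0) (n m : Λ) {x : Λ → E} (hx : ‖x n‖ = 1) :
    siteGrad n (squareTerm U n m) x = tangentKick ((2 * ⟪U n m (x m), x n⟫) • U n m (x m)) (x n) := by
  rw [siteGrad_of_quadratic hx (squareTerm_update_self hU0 n m x), ← add_smul, ← two_mul]

/-- **Square term, gradient at site `m`** (`m ≠ n`): `∂̃_m c = P_{x_m}(2⟪w, x_m⟫ w)`, `w = U_{mn} x_n`. -/
theorem siteGrad_squareTerm_other_site (hUadj : ∀ m n (v w : E), ⟪U m n v, w⟫ = ⟪v, U n m w⟫)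
    {n m : Λ} (hmn : m ≠ n) {x : Λ → E} (hx : ‖x m‖ = 1) :
    siteGrad m (squareTerm U n m) x = tangentKick ((2 * ⟪U m n (x n), x m⟫) • U m n (x n)) (x m) := by
  rw [siteGrad_of_quadratic hx (squareTerm_update_other_site hUadj hmn x), ← add_smul, ← two_mul]

/-- **Square term, gradient at a third site**: `0`. -/
theorem siteGrad_squareTerm_other {n m k : Λ} (hkn : k ≠ n) (hkm : k ≠ m) (x : Λ → E) :
    siteGrad k (squareTerm U n m) x = 0 :=
  siteGrad_of_const (c := squareTerm U n m x) fun y => squareTerm_update_other hkn hkm x y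

end Terms

end Summit.Ventures.LatticeQCDFlow.Exactness

end
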